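import Literature.Analysis.FluidPDE.LeiZhang2017SliceInequality
import Literature.Analysis.FluidPDE.TaoClassSliceData
import Literature.Analysis.FluidPDE.TaoClassQuotientBalance
import Literature.Analysis.FluidPDE.ClassicalL2Stability
import Literature.Analysis.FluidPDE.SerrinEnstrophyGronwall
import Literature.Analysis.FluidPDE.ConstantinDirectionDissipationProofs
import HarnessLib

/-!
# Lei–Zhang 2017, proof of Cor. 1.3: the a-priori estimate (E8) in Tao's class

Analysis/FluidPDE proof file (theorems only; no definitions, no named facts) on the discharge path
of the named fact `Literature.Analysis.FluidPDE.LeiZhang2017_logModulus_regularity`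
(Lei–Zhang 2017, arXiv:1505.02628, Cor. 1.3). §3, p. 9:

> "Integrating the above inequality [(E7)] with respect to time, we get
> (E8) `J ∈ L^∞L² ∩ L²H¹, Ω ∈ L^∞L² ∩ L²H¹ on [0, T]`."

Here this is carried out for a Tao-class solution `v` of the unforced system (`ν = 1`) on `[0, T]`
with axisymmetric slices, under the modulus `|Γ(t,x)| ≤ C₁/ln² r(x)` for `0 < r ≤ 2δ`, `t ∈ [0,T)`
and the bound `|Γ| ≤ M` (smallness `65536 C₁⁴ ≤ ln²(2δ)`, `2δ < 1`):

* `IsTaoSolutionOn.leiZhang_slice` — the fixed-time inequality `LeiZhang2017.slice_inequality`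
  with all its `L²`-hypotheses discharged in Tao's class (`TaoClassSliceData`);
* `IsTaoSolutionOn.leiZhang_E8_energy` — for `b ∈ [0, T]`,
  `‖Ω(b)‖² + 8C_*²‖J(b)‖² ≤ ‖Ω(0)‖² + 8C_*²‖J(0)‖² + 2K ∫₀ᵇ (‖v‖² + ∫|∇v|²_F)` and
  `∫⁻₀ᵇ (¼‖∇Ω‖² + 2C_*²‖∇J‖²) ≤ ½(‖Ω(0)‖² + 8C_*²‖J(0)‖²) + K ∫₀ᵇ (‖v‖² + ∫|∇v|²_F)`
  (the `L²` balances of `TaoClassQuotientBalance`);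
* `IsTaoSolutionOn.leiZhang_E8` — the same with the energy bound
  `∫₀ᵇ (‖v‖² + ∫|∇v|²_F) ≤ (2T + 1)·E(u₀)` (`E = ½‖·‖²`; Leray–Hopf energy inequality of Tao-class
  solutions, `IsLerayHopfOn.lintegral_frobeniusNormSq_fderiv_of_classical`).

## References

* Z. Lei, Q. S. Zhang, Pacific J. Math. 289 (2017) 169–187, arXiv:1505.02628, §3 (E7)–(E8), p. 9.
  [`LeiZhang2017`]
-/

noncomputable section

open MeasureTheory Set Function Filter Topology InnerProductSpace WithLp
open scoped RealInnerProductSpace ContDiff ENNReal NNReal Topology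

namespace Literature.Analysis.FluidPDE

namespace LeiZhang2017

section E8

variable {T : ℝ} {u₀ : EuclideanSpace ℝ (Fin 3) → EuclideanSpace ℝ (Fin 3)}
  {v : ℝ → EuclideanSpace ℝ (Fin 3) → EuclideanSpace ℝ (Fin 3)} {q : ℝ → EuclideanSpace ℝ (Fin 3) → ℝ}

/-- **The slice inequality in Tao's class.** [cite: LeiZhang2017, §3 (E5)–(E7), pp. 8–9] -/
theorem _root_.Literature.Analysis.FluidPDE.IsTaoSolutionOn.leiZhang_slice
    (h : IsTaoSolutionOn T 1 u₀ v q) (hT : 0 < T) (hax : ∀ t ∈ Icc 0 T, IsAxisymmetric (v t))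
    {t : ℝ} (ht : t ∈ Icc 0 T)
    {C₁ M δ : ℝ} (hC₁ : 1 ≤ C₁) (hM : 0 ≤ M) (hδ : 0 < δ) (h2δ : 2 * δ < 1)
    (hsmall : 65536 * C₁ ^ 4 ≤ Real.log (2 * δ) ^ 2)
    (hmod : ∀ x, 0 < cylRadius x → cylRadius x ≤ 2 * δ →
      |swirl (v t) x| ≤ C₁ / Real.log (cylRadius x) ^ 2)
    (hbd : ∀ x, |swirl (v t) x| ≤ M)
    {K : ℝ} (hK : K = ((16 * C₁ * Wei2016.stDerivBound ^ 2 + 2 * M) / δ ^ 2 / (2 * (16 * C₁)) +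
        2 * (16 * C₁) * ((16 * C₁ * Wei2016.stDerivBound ^ 2 + 2 * M) / δ ^ 2)) *
        ‖(curlCLM : (EuclideanSpace ℝ (Fin 3) →L[ℝ] EuclideanSpace ℝ (Fin 3)) →L[ℝ]
          EuclideanSpace ℝ (Fin 3))‖ ^ 2 * δ⁻¹ ^ 2 +
      4 * (16 * C₁) ^ 2 * ((16 * C₁ ^ 2 * Wei2016.stDerivBound ^ 2 / Real.log (2 * δ) ^ 2 + 2 * M ^ 2) / δ ^ 2) *
        (18 / δ ^ 4 + 2 / δ ^ 2)) :
    (∫ x, angVortQuot (v t) x * angVortQuot (timeDerivWithin (Icc 0 T) v t) x) +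
      8 * (16 * C₁) ^ 2 * (∫ x, radVelQuot (curl (v t)) x * radVelQuot (curl (timeDerivWithin (Icc 0 T) v t)) x) +
      (1 / 4) * (∫ x, (fderiv ℝ (angVortQuot (v t)) x (EuclideanSpace.single 0 1) ^ 2 +
        fderiv ℝ (angVortQuot (v t)) x (EuclideanSpace.single 1 1) ^ 2 +
        fderiv ℝ (angVortQuot (v t)) x (EuclideanSpace.single 2 1) ^ 2)) +
      2 * (16 * C₁) ^ 2 * (∫ x, (fderiv ℝ (radVelQuot (curl (v t))) x (EuclideanSpace.single 0 1) ^ 2 +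
        fderiv ℝ (radVelQuot (curl (v t))) x (EuclideanSpace.single 1 1) ^ 2 +
        fderiv ℝ (radVelQuot (curl (v t))) x (EuclideanSpace.single 2 1) ^ 2)) ≤
      K * ((∫ x, ‖v t x‖ ^ 2) + ∫ x, ‖fderiv ℝ (v t) x‖ ^ 2) := by
  obtain ⟨B, -, hB⟩ := h.exists_bound_velocity
  obtain ⟨B', -, hB'⟩ := h.exists_bound_fderiv_velocity
  obtain ⟨hΩ0, hΩ1, hΩ2, hqΩ⟩ := h.memLp_angVortQuot_data hax ht
  obtain ⟨hJ0, hJ1, hJ2, hqJ⟩ := h.memLp_radVelQuot_curl_data hax ht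
  obtain ⟨hW1, hW2, hW3, hqW, hqW2⟩ := h.memLp_radVelQuot_data hax ht
  exact slice_inequality h.classical (uniqueDiffOn_Icc hT) (Icc_subset_closure_interior_Icc' hT) hax ht
    hC₁ hM hδ h2δ hsmall hmod hbd (hB t ht) (hB' t ht) (h.integrable_norm_sq ht)
    (h.integrable_norm_fderiv_sq ht) hΩ0 hΩ1 hΩ2 hqΩ hJ0 hJ1 hJ2 hqJ hW1 hW2 hW3 hqW hqW2 hK

/-- Continuity on `[0, T]` of `t ↦ ∫‖v t‖²` and `t ↦ ∫|∇v(t)|²_F` along a Tao-class solution, and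
integrability of `|∇v(t)|²_F` with `∫‖Dv(t)‖² ≤ ∫|∇v(t)|²_F`. [folklore] -/
theorem _root_.Literature.Analysis.FluidPDE.IsTaoSolutionOn.continuousOn_energies {ν : ℝ}
    (h : IsTaoSolutionOn T ν u₀ v q) (hT : 0 < T) :
    ContinuousOn (fun t => ∫ x, ‖v t x‖ ^ 2) (Icc 0 T) ∧
    ContinuousOn (fun t => ∫ x, frobeniusNormSq (fderiv ℝ (v t) x)) (Icc 0 T) ∧
    ∀ t ∈ Icc 0 T, Integrable (fun x => frobeniusNormSq (fderiv ℝ (v t) x)) ∧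
      ∫ x, ‖fderiv ℝ (v t) x‖ ^ 2 ≤ ∫ x, frobeniusNormSq (fderiv ℝ (v t) x) := by
  have hsm : IsSmoothSpaceTimeOn (Icc 0 T) v := h.classical.smooth_velocity
  obtain ⟨C₀, hC₀⟩ := h.sobolev 0
  obtain ⟨D₀, hD₀⟩ := h.sobolev_dt 0
  obtain ⟨C₁, hC₁⟩ := h.sobolev 1
  obtain ⟨D₁, hD₁⟩ := h.sobolev_dt 1
  have e0 : ∀ (f : EuclideanSpace ℝ (Fin 3) → EuclideanSpace ℝ (Fin 3)),
      ∫⁻ x, ‖f x‖ₑ ^ 2 = ∫⁻ x, ‖iteratedFDeriv ℝ 0 f x‖ₑ ^ 2 :=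
    fun f => lintegral_congr fun x => by rw [← ofReal_norm, ← ofReal_norm, norm_iteratedFDeriv_zero]
  have hl2 := hsm.l2_balance hT (C₀ := C₀) (C₁ := D₀) (fun t ht => by rw [e0]; exact hC₀ t ht)
    (fun t ht => by rw [e0]; exact hD₀ t ht)
  have hen := hsm.enstrophy_balance hT hC₁ hD₁
  refine ⟨hl2.2.1, hen.2.1, fun t ht => ?_⟩
  have hv : ContDiff ℝ ∞ (v t) := h.classical.contDiff_velocity ht
  have hi1 := h.integrable_norm_fderiv_sq ht
  have hint : Integrable (fun x => frobeniusNormSq (fderiv ℝ (v t) x)) := by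
    refine (hi1.const_mul 3).mono' (continuous_frobeniusNormSq_fderiv hv (by simp)).aestronglyMeasurable
      (Eventually.of_forall fun x => ?_)
    rw [Real.norm_eq_abs, abs_of_nonneg (frobeniusNormSq_nonneg _)]
    exact frobeniusNormSq_le_three_mul _
  exact ⟨hint, integral_mono hi1 hint fun x => sq_opNorm_le_frobeniusNormSq _⟩

/-- **(E8), energy form.** Along a Tao-class solution of the unforced system (`ν = 1`) on `[0, T]`
with axisymmetric slices, under the modulus `|Γ(t,x)| ≤ C₁/ln² r(x)` (`0 < r ≤ 2δ`, `t ∈ [0,T)`),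
`|Γ| ≤ M`, `65536 C₁⁴ ≤ ln²(2δ)`, `2δ < 1`: for `b ∈ [0, T]`,
`‖Ω(b)‖² + 8C_*²‖J(b)‖² ≤ ‖Ω(0)‖² + 8C_*²‖J(0)‖² + 2K∫₀ᵇ(‖v‖² + ∫|∇v|²_F)` and
`∫⁻₀ᵇ(¼‖∇Ω‖² + 2C_*²‖∇J‖²) ≤ ½(‖Ω(0)‖² + 8C_*²‖J(0)‖²) + K∫₀ᵇ(‖v‖² + ∫|∇v|²_F)`.
[cite: LeiZhang2017, §3 (E7)–(E8), p. 9] -/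
theorem _root_.Literature.Analysis.FluidPDE.IsTaoSolutionOn.leiZhang_E8_energy
    (h : IsTaoSolutionOn T 1 u₀ v q) (hT : 0 < T) (hax : ∀ t ∈ Icc 0 T, IsAxisymmetric (v t))
    {C₁ M δ : ℝ} (hC₁ : 1 ≤ C₁) (hM : 0 ≤ M) (hδ : 0 < δ) (h2δ : 2 * δ < 1)
    (hsmall : 65536 * C₁ ^ 4 ≤ Real.log (2 * δ) ^ 2)
    (hmod : ∀ t ∈ Ico 0 T, ∀ x, 0 < cylRadius x → cylRadius x ≤ 2 * δ →
      |swirl (v t) x| ≤ C₁ / Real.log (cylRadius x) ^ 2)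
    (hbd : ∀ t ∈ Icc 0 T, ∀ x, |swirl (v t) x| ≤ M)
    {K : ℝ} (hK : K = ((16 * C₁ * Wei2016.stDerivBound ^ 2 + 2 * M) / δ ^ 2 / (2 * (16 * C₁)) +
        2 * (16 * C₁) * ((16 * C₁ * Wei2016.stDerivBound ^ 2 + 2 * M) / δ ^ 2)) *
        ‖(curlCLM : (EuclideanSpace ℝ (Fin 3) →L[ℝ] EuclideanSpace ℝ (Fin 3)) →L[ℝ]
          EuclideanSpace ℝ (Fin 3))‖ ^ 2 * δ⁻¹ ^ 2 +
      4 * (16 * C₁) ^ 2 * ((16 * C₁ ^ 2 * Wei2016.stDerivBound ^ 2 / Real.log (2 * δ) ^ 2 + 2 * M ^ 2) / δ ^ 2) *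
        (18 / δ ^ 4 + 2 / δ ^ 2))
    {b : ℝ} (hb : b ∈ Icc 0 T) :
    (∫ x, angVortQuot (v b) x ^ 2) + 8 * (16 * C₁) ^ 2 * (∫ x, radVelQuot (curl (v b)) x ^ 2) ≤
      (∫ x, angVortQuot (v 0) x ^ 2) + 8 * (16 * C₁) ^ 2 * (∫ x, radVelQuot (curl (v 0)) x ^ 2) +
        2 * K * ∫ t in Ioo 0 b, ((∫ x, ‖v t x‖ ^ 2) + ∫ x, frobeniusNormSq (fderiv ℝ (v t) x)) ∧
    ∫⁻ t in Ioo 0 b, ENNReal.ofReal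
        ((1 / 4) * (∫ x, (fderiv ℝ (angVortQuot (v t)) x (EuclideanSpace.single 0 1) ^ 2 +
          fderiv ℝ (angVortQuot (v t)) x (EuclideanSpace.single 1 1) ^ 2 +
          fderiv ℝ (angVortQuot (v t)) x (EuclideanSpace.single 2 1) ^ 2)) +
        2 * (16 * C₁) ^ 2 * (∫ x, (fderiv ℝ (radVelQuot (curl (v t))) x (EuclideanSpace.single 0 1) ^ 2 +
          fderiv ℝ (radVelQuot (curl (v t))) x (EuclideanSpace.single 1 1) ^ 2 +
          fderiv ℝ (radVelQuot (curl (v t))) x (EuclideanSpace.single 2 1) ^ 2))) ≤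
      ENNReal.ofReal ((1 / 2) * ((∫ x, angVortQuot (v 0) x ^ 2) +
          8 * (16 * C₁) ^ 2 * (∫ x, radVelQuot (curl (v 0)) x ^ 2)) +
        K * ∫ t in Ioo 0 b, ((∫ x, ‖v t x‖ ^ 2) + ∫ x, frobeniusNormSq (fderiv ℝ (v t) x))) := by
  -- names
  set Cs : ℝ := 16 * C₁ with hCs
  set aΩ : ℝ → ℝ := fun t => ∫ x, angVortQuot (v t) x * angVortQuot (timeDerivWithin (Icc 0 T) v t) x with haΩ
  set aJ : ℝ → ℝ := fun t => ∫ x, radVelQuot (curl (v t)) x *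
    radVelQuot (curl (timeDerivWithin (Icc 0 T) v t)) x with haJ
  set GΩ : ℝ → ℝ := fun t => ∫ x, (fderiv ℝ (angVortQuot (v t)) x (EuclideanSpace.single 0 1) ^ 2 +
    fderiv ℝ (angVortQuot (v t)) x (EuclideanSpace.single 1 1) ^ 2 +
    fderiv ℝ (angVortQuot (v t)) x (EuclideanSpace.single 2 1) ^ 2) with hGΩ
  set GJ : ℝ → ℝ := fun t => ∫ x, (fderiv ℝ (radVelQuot (curl (v t))) x (EuclideanSpace.single 0 1) ^ 2 +
    fderiv ℝ (radVelQuot (curl (v t))) x (EuclideanSpace.single 1 1) ^ 2 +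
    fderiv ℝ (radVelQuot (curl (v t))) x (EuclideanSpace.single 2 1) ^ 2) with hGJ
  set E0 : ℝ → ℝ := fun t => ∫ x, ‖v t x‖ ^ 2 with hE0
  set E1 : ℝ → ℝ := fun t => ∫ x, ‖fderiv ℝ (v t) x‖ ^ 2 with hE1
  set E1F : ℝ → ℝ := fun t => ∫ x, frobeniusNormSq (fderiv ℝ (v t) x) with hE1F
  set NΩ : ℝ → ℝ := fun t => ∫ x, angVortQuot (v t) x ^ 2 with hNΩ
  set NJ : ℝ → ℝ := fun t => ∫ x, radVelQuot (curl (v t)) x ^ 2 with hNJ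
  -- constants
  have hCs0 : 0 < Cs := by rw [hCs]; linarith
  have hK0 : 0 ≤ K := by
    rw [hK]
    have := Wei2016.stDerivBound_spec.1
    have hlog : 0 < Real.log (2 * δ) ^ 2 := sq_pos_of_neg (Real.log_neg (by positivity) h2δ)
    positivity
  -- pointwise facts
  have hGΩ0 : ∀ t, 0 ≤ GΩ t := fun t => integral_nonneg fun x => by positivity
  have hGJ0 : ∀ t, 0 ≤ GJ t := fun t => integral_nonneg fun x => by positivity
  have hNΩ0 : ∀ t, 0 ≤ NΩ t := fun t => integral_nonneg fun x => by positivity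
  have hNJ0 : ∀ t, 0 ≤ NJ t := fun t => integral_nonneg fun x => by positivity
  obtain ⟨cE0, cE1F, hEt⟩ := h.continuousOn_energies hT
  -- the slice inequality on `[0, T)`
  have hslice : ∀ t ∈ Ico 0 T, aΩ t + 8 * Cs ^ 2 * aJ t + (1 / 4) * GΩ t + 2 * Cs ^ 2 * GJ t ≤
      K * (E0 t + E1F t) := by
    intro t ht
    have htI : t ∈ Icc 0 T := Ico_subset_Icc_self ht
    have hs := h.leiZhang_slice hT hax htI hC₁ hM hδ h2δ hsmall (hmod t ht) (hbd t htI) hK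
    have hE : K * (E0 t + E1 t) ≤ K * (E0 t + E1F t) :=
      mul_le_mul_of_nonneg_left (by linarith [(hEt t htI).2]) hK0
    exact hs.trans hE
  -- integrability in time
  have iΩ := h.integrableOn_integral_angVortQuot_mul hT hax
  have iJ := h.integrableOn_integral_radVelQuot_curl_mul hT hax
  have iE : IntegrableOn (fun t => E0 t + E1F t) (Icc 0 T) :=
    (cE0.integrableOn_compact isCompact_Icc).add (cE1F.integrableOn_compact isCompact_Icc)
  -- the case `b = 0`
  rcases eq_or_lt_of_le hb.1 with hb0 | hb0
  · subst hb0
    simp only [Ioo_self, Measure.restrict_empty, integral_zero_measure, lintegral_zero_measure,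
      mul_zero, add_zero, zero_le, and_true, le_refl]
  have hbI : b ∈ Ioc 0 T := ⟨hb0, hb.2⟩
  have hsub : Ioo 0 b ⊆ Ioo 0 T := Ioo_subset_Ioo le_rfl hb.2
  have hsub' : Ioo 0 b ⊆ Ico 0 T := fun t ht => ⟨ht.1.le, ht.2.trans_le hb.2⟩
  have iΩb : IntegrableOn aΩ (Ioo 0 b) := iΩ.mono_set hsub
  have iJb : IntegrableOn aJ (Ioo 0 b) := iJ.mono_set hsub
  have iEb : IntegrableOn (fun t => E0 t + E1F t) (Ioo 0 b) :=
    iE.mono_set (hsub.trans Ioo_subset_Icc_self)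
  -- the balances
  have balΩ : NΩ b = NΩ 0 + 2 * ∫ t in Ioo 0 b, aΩ t := h.integral_sq_angVortQuot_eq hT hax hbI
  have balJ : NJ b = NJ 0 + 2 * ∫ t in Ioo 0 b, aJ t := h.integral_sq_radVelQuot_curl_eq hT hax hbI
  -- `∫ (aΩ + 8Cs² aJ) ≤ K ∫ (E0 + E1F)`
  have iA : IntegrableOn (fun t => aΩ t + 8 * Cs ^ 2 * aJ t) (Ioo 0 b) := iΩb.add (iJb.const_mul _)
  have hA_le : ∫ t in Ioo 0 b, (aΩ t + 8 * Cs ^ 2 * aJ t) ≤ ∫ t in Ioo 0 b, K * (E0 t + E1F t) := by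
    refine setIntegral_mono_on iA (iEb.const_mul K) measurableSet_Ioo fun t ht => ?_
    have hs := hslice t (hsub' ht)
    have := hGΩ0 t
    have := hGJ0 t
    nlinarith [hCs0]
  have hA_eq : ∫ t in Ioo 0 b, (aΩ t + 8 * Cs ^ 2 * aJ t) =
      (∫ t in Ioo 0 b, aΩ t) + 8 * Cs ^ 2 * ∫ t in Ioo 0 b, aJ t := by
    rw [integral_add iΩb (iJb.const_mul _), integral_const_mul]
  have hKE : ∫ t in Ioo 0 b, K * (E0 t + E1F t) = K * ∫ t in Ioo 0 b, (E0 t + E1F t) :=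
    integral_const_mul _ _
  refine ⟨?_, ?_⟩
  · -- (B1)
    have : NΩ b + 8 * Cs ^ 2 * NJ b = NΩ 0 + 8 * Cs ^ 2 * NJ 0 +
        2 * ((∫ t in Ioo 0 b, aΩ t) + 8 * Cs ^ 2 * ∫ t in Ioo 0 b, aJ t) := by
      rw [balΩ, balJ]; ring
    rw [this, ← hA_eq]
    rw [hKE] at hA_le
    linarith
  · -- (B2)
    set ψ : ℝ → ℝ := fun t => K * (E0 t + E1F t) - (aΩ t + 8 * Cs ^ 2 * aJ t) with hψ
    have iψ : IntegrableOn ψ (Ioo 0 b) := (iEb.const_mul K).sub iA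
    have hψge : ∀ t ∈ Ioo 0 b, (1 / 4) * GΩ t + 2 * Cs ^ 2 * GJ t ≤ ψ t := by
      intro t ht
      have hs := hslice t (hsub' ht)
      simp only [hψ]
      linarith
    have hψ0 : ∀ t ∈ Ioo 0 b, 0 ≤ ψ t := fun t ht => by
      have := hψge t ht
      have := hGΩ0 t
      have := hGJ0 t
      nlinarith [hCs0]
    calc ∫⁻ t in Ioo 0 b, ENNReal.ofReal ((1 / 4) * GΩ t + 2 * Cs ^ 2 * GJ t)
        ≤ ∫⁻ t in Ioo 0 b, ENNReal.ofReal (ψ t) :=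
          setLIntegral_mono' measurableSet_Ioo fun t ht => ENNReal.ofReal_le_ofReal (hψge t ht)
      _ = ENNReal.ofReal (∫ t in Ioo 0 b, ψ t) := by
          rw [ofReal_integral_eq_lintegral_ofReal iψ]
          exact (ae_restrict_iff' measurableSet_Ioo).2 (Eventually.of_forall hψ0)
      _ ≤ _ := by
          refine ENNReal.ofReal_le_ofReal ?_
          have e : ∫ t in Ioo 0 b, ψ t = K * (∫ t in Ioo 0 b, (E0 t + E1F t)) -
              ((∫ t in Ioo 0 b, aΩ t) + 8 * Cs ^ 2 * ∫ t in Ioo 0 b, aJ t) := by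
            simp only [hψ]
            rw [integral_sub (iEb.const_mul K) iA, hKE, hA_eq]
          rw [e]
          have hpos : 0 ≤ NΩ b + 8 * Cs ^ 2 * NJ b := by
            have := hNΩ0 b; have := hNJ0 b; positivity
          have : NΩ b + 8 * Cs ^ 2 * NJ b = NΩ 0 + 8 * Cs ^ 2 * NJ 0 +
              2 * ((∫ t in Ioo 0 b, aΩ t) + 8 * Cs ^ 2 * ∫ t in Ioo 0 b, aJ t) := by
            rw [balΩ, balJ]; ring
          linarith

/-- **(E8), majorant form** (for the Gronwall steps downstream): under the hypotheses of
`leiZhang_E8_energy` there is a function `ψ`, integrable on `(0, T)`, with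
`¼‖∇Ω(t)‖² + 2C_*²‖∇J(t)‖² ≤ ψ(t)` for `t ∈ (0, T)` and
`∫_{(0,b)} ψ ≤ ½(‖Ω(0)‖² + 8C_*²‖J(0)‖²) + K∫₀ᵇ(‖v‖² + ∫|∇v|²_F)` for `b ∈ (0, T]`
(namely `ψ = K(‖v‖² + ∫|∇v|²_F) − (∫ΩΩ' + 8C_*²∫JJ')`). [cite: LeiZhang2017, §3 (E7)–(E8), p. 9] -/
theorem _root_.Literature.Analysis.FluidPDE.IsTaoSolutionOn.leiZhang_E8_majorant
    (h : IsTaoSolutionOn T 1 u₀ v q) (hT : 0 < T) (hax : ∀ t ∈ Icc 0 T, IsAxisymmetric (v t))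
    {C₁ M δ : ℝ} (hC₁ : 1 ≤ C₁) (hM : 0 ≤ M) (hδ : 0 < δ) (h2δ : 2 * δ < 1)
    (hsmall : 65536 * C₁ ^ 4 ≤ Real.log (2 * δ) ^ 2)
    (hmod : ∀ t ∈ Ico 0 T, ∀ x, 0 < cylRadius x → cylRadius x ≤ 2 * δ →
      |swirl (v t) x| ≤ C₁ / Real.log (cylRadius x) ^ 2)
    (hbd : ∀ t ∈ Icc 0 T, ∀ x, |swirl (v t) x| ≤ M)
    {K : ℝ} (hK : K = ((16 * C₁ * Wei2016.stDerivBound ^ 2 + 2 * M) / δ ^ 2 / (2 * (16 * C₁)) +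
        2 * (16 * C₁) * ((16 * C₁ * Wei2016.stDerivBound ^ 2 + 2 * M) / δ ^ 2)) *
        ‖(curlCLM : (EuclideanSpace ℝ (Fin 3) →L[ℝ] EuclideanSpace ℝ (Fin 3)) →L[ℝ]
          EuclideanSpace ℝ (Fin 3))‖ ^ 2 * δ⁻¹ ^ 2 +
      4 * (16 * C₁) ^ 2 * ((16 * C₁ ^ 2 * Wei2016.stDerivBound ^ 2 / Real.log (2 * δ) ^ 2 + 2 * M ^ 2) / δ ^ 2) *
        (18 / δ ^ 4 + 2 / δ ^ 2)) :
    ∃ ψ : ℝ → ℝ, IntegrableOn ψ (Ioo 0 T) ∧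
      (∀ t ∈ Ioo 0 T,
        (1 / 4) * (∫ x, (fderiv ℝ (angVortQuot (v t)) x (EuclideanSpace.single 0 1) ^ 2 +
          fderiv ℝ (angVortQuot (v t)) x (EuclideanSpace.single 1 1) ^ 2 +
          fderiv ℝ (angVortQuot (v t)) x (EuclideanSpace.single 2 1) ^ 2)) +
        2 * (16 * C₁) ^ 2 * (∫ x, (fderiv ℝ (radVelQuot (curl (v t))) x (EuclideanSpace.single 0 1) ^ 2 +
          fderiv ℝ (radVelQuot (curl (v t))) x (EuclideanSpace.single 1 1) ^ 2 +
          fderiv ℝ (radVelQuot (curl (v t))) x (EuclideanSpace.single 2 1) ^ 2)) ≤ ψ t) ∧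
      ∀ b ∈ Ioc 0 T, ∫ t in Ioo 0 b, ψ t ≤
        (1 / 2) * ((∫ x, angVortQuot (v 0) x ^ 2) + 8 * (16 * C₁) ^ 2 * (∫ x, radVelQuot (curl (v 0)) x ^ 2)) +
          K * ∫ t in Ioo 0 b, ((∫ x, ‖v t x‖ ^ 2) + ∫ x, frobeniusNormSq (fderiv ℝ (v t) x)) := by
  set Cs : ℝ := 16 * C₁ with hCs
  set aΩ : ℝ → ℝ := fun t => ∫ x, angVortQuot (v t) x * angVortQuot (timeDerivWithin (Icc 0 T) v t) x with haΩ
  set aJ : ℝ → ℝ := fun t => ∫ x, radVelQuot (curl (v t)) x *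
    radVelQuot (curl (timeDerivWithin (Icc 0 T) v t)) x with haJ
  set E0 : ℝ → ℝ := fun t => ∫ x, ‖v t x‖ ^ 2 with hE0
  set E1 : ℝ → ℝ := fun t => ∫ x, ‖fderiv ℝ (v t) x‖ ^ 2 with hE1
  set E1F : ℝ → ℝ := fun t => ∫ x, frobeniusNormSq (fderiv ℝ (v t) x) with hE1F
  set NΩ : ℝ → ℝ := fun t => ∫ x, angVortQuot (v t) x ^ 2 with hNΩ
  set NJ : ℝ → ℝ := fun t => ∫ x, radVelQuot (curl (v t)) x ^ 2 with hNJ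
  have hCs0 : 0 < Cs := by rw [hCs]; linarith
  have hK0 : 0 ≤ K := by
    rw [hK]
    have := Wei2016.stDerivBound_spec.1
    have hlog : 0 < Real.log (2 * δ) ^ 2 := sq_pos_of_neg (Real.log_neg (by positivity) h2δ)
    positivity
  have hNΩ0 : ∀ t, 0 ≤ NΩ t := fun t => integral_nonneg fun x => by positivity
  have hNJ0 : ∀ t, 0 ≤ NJ t := fun t => integral_nonneg fun x => by positivity
  obtain ⟨cE0, cE1F, hEt⟩ := h.continuousOn_energies hT
  have iΩ := h.integrableOn_integral_angVortQuot_mul hT hax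
  have iJ := h.integrableOn_integral_radVelQuot_curl_mul hT hax
  have iE : IntegrableOn (fun t => E0 t + E1F t) (Ioo 0 T) :=
    ((cE0.integrableOn_compact isCompact_Icc).add (cE1F.integrableOn_compact isCompact_Icc)).mono_set
      Ioo_subset_Icc_self
  set ψ : ℝ → ℝ := fun t => K * (E0 t + E1F t) - (aΩ t + 8 * Cs ^ 2 * aJ t) with hψ
  have iA : IntegrableOn (fun t => aΩ t + 8 * Cs ^ 2 * aJ t) (Ioo 0 T) := iΩ.add (iJ.const_mul _)
  have iψ : IntegrableOn ψ (Ioo 0 T) := (iE.const_mul K).sub iA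
  refine ⟨ψ, iψ, fun t ht => ?_, fun b hb => ?_⟩
  · have htI : t ∈ Icc 0 T := Ioo_subset_Icc_self ht
    have hs := h.leiZhang_slice hT hax htI hC₁ hM hδ h2δ hsmall (hmod t ⟨ht.1.le, ht.2⟩) (hbd t htI) hK
    have hE : K * (E0 t + E1 t) ≤ K * (E0 t + E1F t) :=
      mul_le_mul_of_nonneg_left (by linarith [(hEt t htI).2]) hK0
    simp only [hψ]
    linarith
  · have hsub : Ioo 0 b ⊆ Ioo 0 T := Ioo_subset_Ioo le_rfl hb.2
    have iΩb : IntegrableOn aΩ (Ioo 0 b) := iΩ.mono_set hsub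
    have iJb : IntegrableOn aJ (Ioo 0 b) := iJ.mono_set hsub
    have iEb : IntegrableOn (fun t => E0 t + E1F t) (Ioo 0 b) := iE.mono_set hsub
    have iAb : IntegrableOn (fun t => aΩ t + 8 * Cs ^ 2 * aJ t) (Ioo 0 b) := iA.mono_set hsub
    have balΩ : NΩ b = NΩ 0 + 2 * ∫ t in Ioo 0 b, aΩ t := h.integral_sq_angVortQuot_eq hT hax hb
    have balJ : NJ b = NJ 0 + 2 * ∫ t in Ioo 0 b, aJ t := h.integral_sq_radVelQuot_curl_eq hT hax hb
    have e : ∫ t in Ioo 0 b, ψ t = K * (∫ t in Ioo 0 b, (E0 t + E1F t)) -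
        ((∫ t in Ioo 0 b, aΩ t) + 8 * Cs ^ 2 * ∫ t in Ioo 0 b, aJ t) := by
      simp only [hψ]
      rw [integral_sub (iEb.const_mul K) iAb, integral_const_mul, integral_add iΩb (iJb.const_mul _),
        integral_const_mul]
    rw [e]
    have hpos : 0 ≤ NΩ b + 8 * Cs ^ 2 * NJ b := by
      have := hNΩ0 b; have := hNJ0 b; positivity
    have : NΩ b + 8 * Cs ^ 2 * NJ b = NΩ 0 + 8 * Cs ^ 2 * NJ 0 +
        2 * ((∫ t in Ioo 0 b, aΩ t) + 8 * Cs ^ 2 * ∫ t in Ioo 0 b, aJ t) := by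
      rw [balΩ, balJ]; ring
    linarith

/-- **The energy input**: along a Tao-class solution of the unforced system (`0 < ν`),
`∫₀ᵇ (‖v‖² + ∫|∇v|²_F) ≤ (2T + 1/ν) E(u₀)` for `b ∈ [0, T]` (Leray–Hopf energy inequality).
[cite: Leray1934, (5.2); folklore] -/
theorem _root_.Literature.Analysis.FluidPDE.IsTaoSolutionOn.integral_energies_le {ν : ℝ}
    (h : IsTaoSolutionOn T ν u₀ v q) (hT : 0 < T) (hν : 0 < ν) {b : ℝ} (hb : b ∈ Icc 0 T) :
    ∫ t in Ioo 0 b, ((∫ x, ‖v t x‖ ^ 2) + ∫ x, frobeniusNormSq (fderiv ℝ (v t) x)) ≤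
      (2 * T + 1 / ν) * VectorCalculus.kineticEnergy u₀ := by
  obtain ⟨cE0, cE1F, hEt⟩ := h.continuousOn_energies hT
  set E0 : ℝ → ℝ := fun t => ∫ x, ‖v t x‖ ^ 2 with hE0
  set E1F : ℝ → ℝ := fun t => ∫ x, frobeniusNormSq (fderiv ℝ (v t) x) with hE1F
  have hkin0 : 0 ≤ VectorCalculus.kineticEnergy u₀ := by
    unfold VectorCalculus.kineticEnergy; positivity
  have hsub : Ioo 0 b ⊆ Icc 0 T := fun t ht => ⟨ht.1.le, ht.2.le.trans hb.2⟩
  have i0 : IntegrableOn E0 (Ioo 0 b) := (cE0.integrableOn_compact isCompact_Icc).mono_set hsub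
  have i1 : IntegrableOn E1F (Ioo 0 b) := (cE1F.integrableOn_compact isCompact_Icc).mono_set hsub
  -- `E0 t ≤ 2 E(u₀)`
  have hE0le : ∀ t ∈ Icc 0 T, E0 t ≤ 2 * VectorCalculus.kineticEnergy u₀ := by
    intro t ht
    have hl := h.lintegral_enorm_sq_le hT hν.le ht
    have hi := h.integrable_norm_sq ht
    have e : ENNReal.ofReal (E0 t) = ∫⁻ x, ‖v t x‖ₑ ^ 2 := by
      rw [hE0, ofReal_integral_eq_lintegral_ofReal hi (Eventually.of_forall fun x => by positivity)]
      refine lintegral_congr fun x => ?_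
      rw [← ofReal_norm, ENNReal.ofReal_pow (norm_nonneg _)]
    have := (ENNReal.ofReal_le_ofReal_iff (by positivity)).1 (e ▸ hl)
    exact this
  have h0int : ∫ t in Ioo 0 b, E0 t ≤ 2 * T * VectorCalculus.kineticEnergy u₀ := by
    calc ∫ t in Ioo 0 b, E0 t ≤ ∫ _ in Ioo 0 b, 2 * VectorCalculus.kineticEnergy u₀ :=
          setIntegral_mono_on i0 (by exact integrableOn_const (by simp)) measurableSet_Ioo
            fun t ht => hE0le t (hsub ht)
      _ = b * (2 * VectorCalculus.kineticEnergy u₀) := by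
          rw [setIntegral_const]; simp [hb.1]
      _ ≤ T * (2 * VectorCalculus.kineticEnergy u₀) :=
          mul_le_mul_of_nonneg_right hb.2 (by positivity)
      _ = 2 * T * VectorCalculus.kineticEnergy u₀ := by ring
  -- `∫₀ᵇ E1F ≤ E(u₀)/ν`
  have hcl : IsClassicalNSSolutionOn (Ico 0 T) ν 0 v q :=
    h.classical.mono Ico_subset_Icc_self (uniqueDiffOn_Ico 0 T)
  have hlh : IsLerayHopfOn T ν 0 (v 0) v := by
    have := h.isLerayHopfOn hT
    rwa [← h.initial] at this
  obtain ⟨hDfin, hDle⟩ := IsLerayHopfOn.lintegral_frobeniusNormSq_fderiv_of_classical hcl hlh hT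
  rw [h.initial] at hDle
  set D : ℝ≥0∞ := ∫⁻ τ in Ioo 0 T, ∫⁻ x, ENNReal.ofReal (frobeniusNormSq (fderiv ℝ (v τ) x)) with hD
  have hsl : ∀ t ∈ Icc 0 T, ENNReal.ofReal (E1F t) =
      ∫⁻ x, ENNReal.ofReal (frobeniusNormSq (fderiv ℝ (v t) x)) := fun t ht => by
    rw [hE1F, ofReal_integral_eq_lintegral_ofReal (hEt t ht).1
      (Eventually.of_forall fun x => frobeniusNormSq_nonneg _)]
  have hI1nn : 0 ≤ ∫ t in Ioo 0 b, E1F t :=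
    setIntegral_nonneg measurableSet_Ioo fun t _ => integral_nonneg fun x => frobeniusNormSq_nonneg _
  have h1int : ∫ t in Ioo 0 b, E1F t ≤ VectorCalculus.kineticEnergy u₀ / ν := by
    have e1 : ENNReal.ofReal (∫ t in Ioo 0 b, E1F t) = ∫⁻ t in Ioo 0 b, ENNReal.ofReal (E1F t) :=
      ofReal_integral_eq_lintegral_ofReal i1 ((ae_restrict_iff' measurableSet_Ioo).2
        (Eventually.of_forall fun t _ => integral_nonneg fun x => frobeniusNormSq_nonneg _))
    have e2 : ∫⁻ t in Ioo 0 b, ENNReal.ofReal (E1F t) ≤ D := by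
      calc ∫⁻ t in Ioo 0 b, ENNReal.ofReal (E1F t)
          = ∫⁻ t in Ioo 0 b, ∫⁻ x, ENNReal.ofReal (frobeniusNormSq (fderiv ℝ (v t) x)) :=
            setLIntegral_congr_fun measurableSet_Ioo fun t ht => hsl t (hsub ht)
        _ ≤ D := lintegral_mono_set (Ioo_subset_Ioo le_rfl hb.2)
    have e3 : (∫ t in Ioo 0 b, E1F t) ≤ D.toReal := by
      have h3 := ENNReal.toReal_mono hDfin (e1 ▸ e2)
      rwa [ENNReal.toReal_ofReal hI1nn] at h3
    have e4 : D.toReal ≤ VectorCalculus.kineticEnergy u₀ / ν := by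
      rw [le_div_iff₀ hν, mul_comm]; exact hDle
    exact e3.trans e4
  rw [integral_add i0 i1]
  calc (∫ t in Ioo 0 b, E0 t) + ∫ t in Ioo 0 b, E1F t
      ≤ 2 * T * VectorCalculus.kineticEnergy u₀ + VectorCalculus.kineticEnergy u₀ / ν := add_le_add h0int h1int
    _ = (2 * T + 1 / ν) * VectorCalculus.kineticEnergy u₀ := by ring

/-- **(E8).** Along a Tao-class solution of the unforced system (`ν = 1`) on `[0, T]` with
axisymmetric slices, under the modulus `|Γ(t,x)| ≤ C₁/ln² r(x)` (`0 < r ≤ 2δ`, `t ∈ [0,T)`),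
`|Γ| ≤ M`, `65536 C₁⁴ ≤ ln²(2δ)`, `2δ < 1`: for every `b ∈ [0, T]`,
`‖Ω(b)‖² + 8C_*²‖J(b)‖² ≤ A` and `∫⁻₀ᵇ (¼‖∇Ω‖² + 2C_*²‖∇J‖²) ≤ A`, with
`A = ‖Ω(0)‖² + 8C_*²‖J(0)‖² + 2K(2T + 1)E(u₀)` depending on `u₀, T, C₁, M, δ` only.
[cite: LeiZhang2017, §3 (E8), p. 9] -/
theorem _root_.Literature.Analysis.FluidPDE.IsTaoSolutionOn.leiZhang_E8
    (h : IsTaoSolutionOn T 1 u₀ v q) (hT : 0 < T) (hax : ∀ t ∈ Icc 0 T, IsAxisymmetric (v t))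
    {C₁ M δ : ℝ} (hC₁ : 1 ≤ C₁) (hM : 0 ≤ M) (hδ : 0 < δ) (h2δ : 2 * δ < 1)
    (hsmall : 65536 * C₁ ^ 4 ≤ Real.log (2 * δ) ^ 2)
    (hmod : ∀ t ∈ Ico 0 T, ∀ x, 0 < cylRadius x → cylRadius x ≤ 2 * δ →
      |swirl (v t) x| ≤ C₁ / Real.log (cylRadius x) ^ 2)
    (hbd : ∀ t ∈ Icc 0 T, ∀ x, |swirl (v t) x| ≤ M)
    {K : ℝ} (hK : K = ((16 * C₁ * Wei2016.stDerivBound ^ 2 + 2 * M) / δ ^ 2 / (2 * (16 * C₁)) +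
        2 * (16 * C₁) * ((16 * C₁ * Wei2016.stDerivBound ^ 2 + 2 * M) / δ ^ 2)) *
        ‖(curlCLM : (EuclideanSpace ℝ (Fin 3) →L[ℝ] EuclideanSpace ℝ (Fin 3)) →L[ℝ]
          EuclideanSpace ℝ (Fin 3))‖ ^ 2 * δ⁻¹ ^ 2 +
      4 * (16 * C₁) ^ 2 * ((16 * C₁ ^ 2 * Wei2016.stDerivBound ^ 2 / Real.log (2 * δ) ^ 2 + 2 * M ^ 2) / δ ^ 2) *
        (18 / δ ^ 4 + 2 / δ ^ 2))
    {b : ℝ} (hb : b ∈ Icc 0 T) :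
    (∫ x, angVortQuot (v b) x ^ 2) + 8 * (16 * C₁) ^ 2 * (∫ x, radVelQuot (curl (v b)) x ^ 2) ≤
      (∫ x, angVortQuot (u₀) x ^ 2) + 8 * (16 * C₁) ^ 2 * (∫ x, radVelQuot (curl u₀) x ^ 2) +
        2 * K * ((2 * T + 1) * VectorCalculus.kineticEnergy u₀) ∧
    ∫⁻ t in Ioo 0 b, ENNReal.ofReal
        ((1 / 4) * (∫ x, (fderiv ℝ (angVortQuot (v t)) x (EuclideanSpace.single 0 1) ^ 2 +
          fderiv ℝ (angVortQuot (v t)) x (EuclideanSpace.single 1 1) ^ 2 +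
          fderiv ℝ (angVortQuot (v t)) x (EuclideanSpace.single 2 1) ^ 2)) +
        2 * (16 * C₁) ^ 2 * (∫ x, (fderiv ℝ (radVelQuot (curl (v t))) x (EuclideanSpace.single 0 1) ^ 2 +
          fderiv ℝ (radVelQuot (curl (v t))) x (EuclideanSpace.single 1 1) ^ 2 +
          fderiv ℝ (radVelQuot (curl (v t))) x (EuclideanSpace.single 2 1) ^ 2))) ≤
      ENNReal.ofReal ((1 / 2) * ((∫ x, angVortQuot u₀ x ^ 2) +
          8 * (16 * C₁) ^ 2 * (∫ x, radVelQuot (curl u₀) x ^ 2)) +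
        K * ((2 * T + 1) * VectorCalculus.kineticEnergy u₀)) := by
  obtain ⟨h1, h2⟩ := h.leiZhang_E8_energy hT hax hC₁ hM hδ h2δ hsmall hmod hbd hK hb
  have hen := h.integral_energies_le hT one_pos hb
  rw [div_one] at hen
  have hK0 : 0 ≤ K := by
    rw [hK]
    have := Wei2016.stDerivBound_spec.1
    have hlog : 0 < Real.log (2 * δ) ^ 2 := sq_pos_of_neg (Real.log_neg (by positivity) h2δ)
    positivity
  rw [h.initial] at h1 h2
  refine ⟨h1.trans ?_, h2.trans (ENNReal.ofReal_le_ofReal ?_)⟩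
  · have := mul_le_mul_of_nonneg_left hen (by positivity : 0 ≤ 2 * K)
    linarith
  · have := mul_le_mul_of_nonneg_left hen hK0
    linarith

end E8

end LeiZhang2017

end Literature.Analysis.FluidPDE
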